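import Summits.QuantumFields.YangMills.Theorems.TransportPerturbationFixedCutoffOverlap
import HarnessLib

/-!
# Route `TransportPerturbation`, LINE 10 «harris_hybrid» (crux K1 `LyapunovContraction`, stmt-QuantumFields-26986): the registered
# plan-only rung `stub_fixedCutoffOverlapRung : FixedCutoffOverlap` BY NAME

Seat `ym-line-csu-p1` (g12).  The skeleton `harris_hybrid_v3.lean` (planner ym-idea-5 g8, registered sha `545739ec5db5…`) states its
BC5 first rung `FixedCutoffOverlap` in its own vocabulary (namespace `Cruxes.LyapunovContraction.HarrisHybrid`: `G2`, `su2Rep`, `avSU`,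
`Cfg`, `IsCoupling`, `toField`, `IsSolFamily`, `avgField`, `fieldDistAt`, `discG`, `wdisc`, `dTr`), copied here VERBATIM (up to the name of one anonymous
instance binder) together with the statement `FixedCutoffOverlap` and its registered alias `__Registered.stub_fixedCutoffOverlapRung`; the theorem
`stub_fixedCutoffOverlapRung` is then the tree's ★★ `SynchronousShadow.fixedCutoffOverlap` (file `TransportPerturbationFixedCutoffOverlap`,
all windows `τ > 0`; the TP vocabulary of `Cruxes.WeightedAlmostInvariance.SynchronousShadow` is the same text, so the two statements
agree definitionally).

HONEST FRAMING: this is the fixed-cut-off rung (classical Doeblin for the elliptic SZZ diffusion on the compact `SU(2)^{E_K}`, with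
`η_K` depending on `K`); the K-UNIFORM organ `RegularPairOverlap` (27873), the other stubs of the line and the crux `LyapunovContraction`
are NOT proved; K1 stays HELD; no summit is proved; the Yang–Mills mass gap is NOT proved.
-/

set_option autoImplicit false

namespace Summit.QuantumFields.YangMills.Cruxes.LyapunovContraction.HarrisHybrid

open scoped BigOperators Topology Classical MeasureTheory ProbabilityTheory NNReal ENNReal
open Filter Set Function MeasureTheory
open Literature.MathematicalPhysics.QuantumFieldTheory
open Literature.MathematicalPhysics.QuantumFieldTheory.Balaban1983to89
open Literature.MathematicalPhysics.QuantumLattice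

/-! ## The skeleton's vocabulary (verbatim from `harris_hybrid_v3.lean`) -/

/-- The gauge group `SU(2)` as `2 × 2` complex matrices. -/
abbrev G2 : Type := Matrix.specialUnitaryGroup (Fin 2) ℂ

/-- The SZZ lattice representation datum of `SU(2)` (verbatim from the crux). -/
noncomputable abbrev su2Rep : LatticeRep G2 :=
  ⟨2, fundamentalRep (Fin 2), continuous_fundamentalRep _, fundamentalRep_injective _, fundamentalRep_mem_unitaryGroup⟩

/-- Bałaban's small-loop average used by the leaf. -/
noncomputable abbrev avSU : LoopAverage G2 := ExpMeanLog.expMeanLogSU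

/-- Step-`K` link configurations of the SZZ dynamics. -/
abbrev Cfg (F : T3ContinuumYM3Torus.T3Family) (K : ℕ) : Type := GaugeConfig 3 ((F.P K).sitesPerDir 0) G2

/-- A COUPLING (in map form) of two copies of the transition operator `f ↦ markovTransition U P t f`: jointly measurable maps
`T₁ T₂ : X → X → Ω₁ → X` on an auxiliary probability space whose marginals from `(x, y)` are the transition laws from `x`
and from `y` (tested on bounded measurable functions). -/
def IsCoupling {X Ω Ω₁ : Type} [MeasurableSpace X] [MeasurableSpace Ω] [MeasurableSpace Ω₁]
    (U : X → ℝ≥0 → Ω → X) (P : Measure Ω) (t : ℝ≥0) (P₁ : Measure Ω₁) (T₁ T₂ : X → X → Ω₁ → X) : Prop :=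
  IsProbabilityMeasure P₁ ∧ Measurable (fun p : (X × X) × Ω₁ => T₁ p.1.1 p.1.2 p.2) ∧
    Measurable (fun p : (X × X) × Ω₁ => T₂ p.1.1 p.1.2 p.2) ∧
    ∀ f : X → ℝ, Measurable f → (∃ M : ℝ, ∀ x, |f x| ≤ M) → ∀ x y,
      (∫ ω, f (T₁ x y ω) ∂P₁) = markovTransition U P t f x ∧ (∫ ω, f (T₂ x y ω) ∂P₁) = markovTransition U P t f y

variable (F : T3ContinuumYM3Torus.T3Family)

/-- A step-`K` link configuration read as a level-0 gauge field of Bałaban's `K`-th lattice. -/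
def toField (K : ℕ) (c : Cfg F K) : GaugeField (F.P K) 0 G2 :=
  fun b : PBond (F.P K) 0 => c (b.src, b.dir)

/-- Jointly measurable strong-solution family of the step-`K` SZZ dynamics from every deterministic start (route shape). -/
def IsSolFamily (γ : ℝ) (K : ℕ) {Ω : Type} [MeasurableSpace Ω] (P : Measure Ω)
    (W : ℝ≥0 → Ω → (Edge 3 ((F.P K).sitesPerDir 0) × NoiseIdx 2 → ℝ)) (hW : IsFlatBrownian W P)
    (V : Cfg F K → ℝ≥0 → Ω → Cfg F K) : Prop :=
  (∀ x, (∀ ω, V x 0 ω = x) ∧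
    (latticeLangevinDynamics su2Rep ((γ * (F.P K).eps)⁻¹ / 2)).IsSolution (fundamentalRep (Fin 2))
      hW.natFiltration P W (V x)) ∧
  ∀ t : ℝ≥0, Measurable (fun p : Cfg F K × Ω => V p.1 t p.2)

/-- The `j`-fold block-averaged field of a step-`K` configuration. -/
noncomputable def avgField (K j : ℕ) (c : Cfg F K) : GaugeField (F.P K) j G2 :=
  Averaging.iter (fun i => BlockAveraging.blockAvg (P := F.P K) (j := i) avSU) j (toField F K c)

/-- Sup-entry distance of two depth-`j` gauge fields. -/
noncomputable def fieldDistAt (K j : ℕ) (V V' : GaugeField (F.P K) j G2) : ℝ :=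
  ⨆ p : PBond (F.P K) j × Fin 2 × Fin 2,
    ‖(V p.1 : Matrix (Fin 2) (Fin 2) ℂ) p.2.1 p.2.2 - (V' p.1 : Matrix (Fin 2) (Fin 2) ℂ) p.2.1 p.2.2‖

/-- Depth-`j` discrepancy modulo the depth-`j` gauge group. -/
noncomputable def discG (K j : ℕ) (u v : Cfg F K) : ℝ :=
  ⨅ h : GaugeTransf (F.P K) j G2, fieldDistAt F K j (avgField F K j u) (GaugeField.gaugeAct h (avgField F K j v))

/-- Scale-weighted transport weight `wd_K = Σ_{j ≤ K} L^{-(K-j)} · discG_j` (the route's currency). -/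
noncomputable def wdisc (K : ℕ) (u v : Cfg F K) : ℝ :=
  ∑ j ∈ Finset.range (K + 1), ((F.L : ℝ)⁻¹) ^ (K - j) * discG F K j u v

/-- The HMS TRUNCATED distance-like function `d_δ = 1 ∧ wd_K/δ` (arXiv:0902.4495 §4.1: pairs beyond `δ` are «far», `d = 1`). -/
noncomputable def dTr (K : ℕ) (δ : ℝ) (u v : Cfg F K) : ℝ :=
  min 1 (wdisc F K u v / δ)

/-- BC5 FIRST RUNG (plan-only, NOT in the composition): the FIXED-CUT-OFF analogue of `RegularPairOverlap` for ALL pairs —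
at each fixed `K` the step-`K` SZZ dynamics is an ELLIPTIC diffusion on the compact manifold `SU(2)^{E_K}` (full-rank flat noise), so
its time-`τ/ε_K` transition kernel has a continuous density bounded below by some `c_K > 0` w.r.t. Haar, and the maximal coupling of two
transition laws meets with probability `≥ η_K > 0`; the truncated currency then has mean `≤ 1 - η_K`.  Classical (Doeblin on a compact
state space; e.g. Meyn–Tweedie ch. 5–6, Stroock–Varadhan support theorem); `η_K` may decay in `K` — the crux 27873 is exactly the
K-UNIFORMITY on regular sublevel sets.  Why it is a rung: it lies outside the known regime of K1/YM3TorusSU2 (nothing cut-off-uniform is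
claimed) yet exercises the line's object (a coupling with prescribed marginals whose truncated-wd mean is bounded away from 1). -/
def FixedCutoffOverlap : Prop :=
  ∀ (F : T3ContinuumYM3Torus.T3Family) (γ : ℝ), 0 < γ → ∀ (K : ℕ) (τ δ : ℝ), 0 < τ → 0 < δ →
    ∃ η : ℝ, 0 < η ∧
      ∀ (Ω : Type) (mΩ : MeasurableSpace Ω) (P : Measure Ω) (_hP : IsProbabilityMeasure P)
        (W : ℝ≥0 → Ω → (Edge 3 ((F.P K).sitesPerDir 0) × NoiseIdx 2 → ℝ)) (hW : IsFlatBrownian W P)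
        (V : Cfg F K → ℝ≥0 → Ω → Cfg F K), IsSolFamily F γ K P W hW V →
        ∃ (Ω₂ : Type) (_ : MeasurableSpace Ω₂) (P₂ : Measure Ω₂) (T₃ T₄ : Cfg F K → Cfg F K → Ω₂ → Cfg F K),
          IsCoupling V P (τ / (F.P K).eps).toNNReal P₂ T₃ T₄ ∧
          ∀ u v, (∫ ω, dTr F K δ (T₃ u v ω) (T₄ u v ω) ∂P₂) ≤ 1 - η

namespace __Registered
/-- registered plan-only rung (BC5) — first prover target of the line at fixed cut-off. -/ abbrev stub_fixedCutoffOverlapRung : Prop := FixedCutoffOverlap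
end __Registered

/-! ## The rung -/

/-- ★★ **The registered plan-only rung of LINE 10 `harris_hybrid`, BY NAME**: `FixedCutoffOverlap` holds — at every fixed cut-off `K`,
for every window `τ > 0` and truncation scale `δ > 0`, every jointly measurable SZZ solution family admits a measurable Doeblin coupling of
its window-`τ/ε_K` transition laws, all pairs of starts, with truncated-`wd_K` mean `≤ 1 − η_K(τ)` (`SynchronousShadow.fixedCutoffOverlap`:
strict positivity of the SU(2) heat kernel ⇒ Doeblin minorisation at every lattice time ⇒ map-form coupling). [folklore] -/
theorem stub_fixedCutoffOverlapRung : __Registered.stub_fixedCutoffOverlapRung := by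
  intro F γ _hγ K τ δ hτ hδ
  obtain ⟨η, hη, h⟩ := WeightedAlmostInvariance.SynchronousShadow.fixedCutoffOverlap F γ K τ δ hτ hδ
  refine ⟨η, hη, fun Ω mΩ P hP W hW V hV => ?_⟩
  obtain ⟨Ω₂, mΩ₂, P₂, T₃, T₄, hC, hmean⟩ := h Ω P W hW V hV
  exact ⟨Ω₂, mΩ₂, P₂, T₃, T₄, hC, hmean⟩

/-- The rung under its mathematical name. [folklore] -/
theorem fixedCutoffOverlap_holds : FixedCutoffOverlap := stub_fixedCutoffOverlapRung

end Summit.QuantumFields.YangMills.Cruxes.LyapunovContraction.HarrisHybrid
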